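import Mathlib
import Literature.Combinatorics.Additive.TripleProductProperty
import Literature.Combinatorics.Additive.TPPGroupAlgebra
import Summits.MatrixMultiplication.MatrixMultiplication.Theses.SnSubsetDichotomy
import Summits.MatrixMultiplication.MatrixMultiplication.Theorems.SnSubsetDichotomyPolynomialSlackStubSplit

/-!
# Route `SnSubsetDichotomy` — support `QuotientSetDeficit` (stmt-MatrixMultiplication-8307)

THE DEFICIT IDENTITY (dense form, any group `G`). For a triple `S, T, U ⊆ G` with the triple
product property (tree convention `Literature.Combinatorics.Additive.TripleProductProperty`:
`s s'⁻¹ · t t'⁻¹ · u u'⁻¹ = 1 ⇒ s = s', t = t', u = u'`) and all three sets non-empty: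

* the quotient sets `S⁻¹T = image₂ (fun s t => s⁻¹ * t) S T`, `T⁻¹U`, `U⁻¹S` have full sizes
  `|S||T|`, `|T||U|`, `|U||S|` — the quotient map `(x, y) ↦ x⁻¹y` is injective on `S × T` as soon as
  the third set has an element (Cohn–Umans 2003, proof of Lemma 3.1; tree lemma
  `Summit.MatrixMultiplication.MatrixMultiplication.Theorems.PolynomialSlack.injOn_quot_first`),
  applied to the three cyclic rotations of the triple (the property is rotation invariant, tree
  lemma `Literature.Combinatorics.Additive.TripleProductProperty.rotate`);
* the number of triples `(a, b, c) ∈ S⁻¹T × T⁻¹U × U⁻¹S` with `abc = 1` is exactly `|S||T||U|`: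
  the map `(s, t, u) ↦ (s⁻¹t, t⁻¹u, u⁻¹s)` is a bijection from `S × T × U` onto these solutions —
  the product telescopes to `1`; it is injective by the quotient-map injectivity on `S × T` and on
  `T × U`; and it is surjective because a solution `s₁⁻¹t₁ · t₂⁻¹u₂ · u₃⁻¹s₃ = 1` conjugated by `s₃`
  is the word `s₃s₁⁻¹ · t₁t₂⁻¹ · u₂u₃⁻¹ = 1`, so the property forces `s₃ = s₁`, `t₁ = t₂`,
  `u₂ = u₃` (unique representation).

References: Cohn–Umans 2003, Lemma 3.1 (proof); Blasiak–Cohn–Grochow–Pratt–Umans 2023, §3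
(the 6-fold convolution count `|S||T||U|`, cf. the tree's
`Literature.Combinatorics.Additive.TripleProductProperty.coeff_one_six`).
-/

-- `Summit.<Summit>.<Problem>` is the tree's mandated summit-side namespace; for this
-- single-conjunct summit the two coincide, so the file silences `dupNamespace`.
set_option linter.dupNamespace false

open Literature.Combinatorics.Additive (TripleProductProperty)
open Summit.MatrixMultiplication.MatrixMultiplication.Theorems.PolynomialSlack (injOn_quot_first)

namespace Summit.MatrixMultiplication.MatrixMultiplication.Theorems

/-- **Unique representation** (the counting half of the deficit identity, for an abstract group).
For a triple `S, T, U` with the triple product property and `S`, `U` non-empty, the map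
`(s, t, u) ↦ (s⁻¹t, t⁻¹u, u⁻¹s)` is a bijection from `S × T × U` onto the triples
`(a, b, c) ∈ S⁻¹T × T⁻¹U × U⁻¹S` with `abc = 1`; in particular there are exactly `|S||T||U|` of
them. [folklore] -/
theorem SnSubsetDichotomy.card_filter_quotient_triples_eq {G : Type*} [Group G] [DecidableEq G]
    {S T U : Finset G} (hTPP : TripleProductProperty S T U) (hS : S.Nonempty) (hU : U.Nonempty) :
    ((Finset.image₂ (fun s t => s⁻¹ * t) S T ×ˢ Finset.image₂ (fun t u => t⁻¹ * u) T U ×ˢ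
        Finset.image₂ (fun u s => u⁻¹ * s) U S).filter
        (fun x => x.1 * x.2.1 * x.2.2 = 1)).card = S.card * T.card * U.card := by
  have i1 := injOn_quot_first hTPP hU
  have i2 := injOn_quot_first hTPP.rotate hS
  rw [show S.card * T.card * U.card = (S ×ˢ T ×ˢ U).card by
    rw [Finset.card_product, Finset.card_product, mul_assoc]]
  symm
  refine Finset.card_nbij
    (fun x : G × G × G => (x.1⁻¹ * x.2.1, x.2.1⁻¹ * x.2.2, x.2.2⁻¹ * x.1)) ?_ ?_ ?_
  · -- well defined: lands in the three quotient sets, and the product telescopes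
    rintro ⟨s, t, u⟩ hx
    simp only [Finset.mem_coe, Finset.mem_product] at hx
    obtain ⟨hs, ht, hu⟩ := hx
    simp only [Finset.mem_coe, Finset.mem_filter, Finset.mem_product]
    exact ⟨⟨Finset.mem_image₂_of_mem hs ht, Finset.mem_image₂_of_mem ht hu,
      Finset.mem_image₂_of_mem hu hs⟩, by group⟩
  · -- injective: quotient-map injectivity on `S × T` and on `T × U`
    rintro ⟨s, t, u⟩ hx ⟨s', t', u'⟩ hx' he
    simp only [Finset.mem_coe, Finset.mem_product] at hx hx'
    simp only [Prod.mk.injEq] at he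
    obtain ⟨he1, he2, -⟩ := he
    have e1 : (s, t) = (s', t') :=
      i1 (Set.mk_mem_prod hx.1 hx.2.1) (Set.mk_mem_prod hx'.1 hx'.2.1) he1
    have e2 : (t, u) = (t', u') :=
      i2 (Set.mk_mem_prod hx.2.1 hx.2.2) (Set.mk_mem_prod hx'.2.1 hx'.2.2) he2
    obtain ⟨rfl, rfl⟩ := Prod.mk.inj e1
    obtain ⟨-, rfl⟩ := Prod.mk.inj e2
    rfl
  · -- surjective: one instance of the triple product property after conjugating by `s₃`
    rintro ⟨a, b, c⟩ hx
    simp only [Finset.mem_coe, Finset.mem_filter, Finset.mem_product, Finset.mem_image₂] at hx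
    obtain ⟨⟨⟨s₁, hs₁, t₁, ht₁, rfl⟩, ⟨t₂, ht₂, u₂, hu₂, rfl⟩, ⟨u₃, hu₃, s₃, hs₃, rfl⟩⟩, habc⟩ := hx
    have key : s₃ * s₁⁻¹ * (t₁ * t₂⁻¹) * (u₂ * u₃⁻¹) = 1 :=
      calc s₃ * s₁⁻¹ * (t₁ * t₂⁻¹) * (u₂ * u₃⁻¹)
          = s₃ * (s₁⁻¹ * t₁ * (t₂⁻¹ * u₂) * (u₃⁻¹ * s₃)) * s₃⁻¹ := by group
        _ = 1 := by rw [habc]; group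
    obtain ⟨e1, e2, e3⟩ := hTPP s₃ hs₃ s₁ hs₁ t₁ ht₁ t₂ ht₂ u₂ hu₂ u₃ hu₃ key
    refine ⟨(s₁, t₁, u₂), ?_, ?_⟩
    · simp only [Finset.mem_coe, Finset.mem_product]
      exact ⟨hs₁, ht₁, hu₂⟩
    · simp only [e1, e2, e3]

/-- **The deficit identity** (route `SnSubsetDichotomy`, support `QuotientSetDeficit`,
stmt-MatrixMultiplication-8307): for a triple `S, T, U` with the triple product property in any
group and all three sets non-empty, `|S⁻¹T| = |S||T|`, `|T⁻¹U| = |T||U|`, `|U⁻¹S| = |U||S|`, and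
`#{(a, b, c) ∈ S⁻¹T × T⁻¹U × U⁻¹S : abc = 1} = |S||T||U|`. The three cardinalities are the
injectivity of `(x, y) ↦ x⁻¹y` (Cohn–Umans 2003, proof of Lemma 3.1) for the three cyclic rotations
of the triple; the count is `SnSubsetDichotomy.card_filter_quotient_triples_eq`. [folklore] -/
theorem quotientSetDeficit_proof :
    Summit.MatrixMultiplication.MatrixMultiplication.Theses.SnSubsetDichotomy.QuotientSetDeficit := by
  unfold Summit.MatrixMultiplication.MatrixMultiplication.Theses.SnSubsetDichotomy.QuotientSetDeficit
  intro G _ _ S T U hTPP hS hT hU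
  exact ⟨Finset.card_image₂_iff.mpr (injOn_quot_first hTPP hU),
    Finset.card_image₂_iff.mpr (injOn_quot_first hTPP.rotate hS),
    Finset.card_image₂_iff.mpr (injOn_quot_first hTPP.rotate.rotate hT),
    SnSubsetDichotomy.card_filter_quotient_triples_eq hTPP hS hU⟩

end Summit.MatrixMultiplication.MatrixMultiplication.Theorems
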